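import Summits.Parity.GeneralizedHardyLittlewood.Theorems.PrimeLevelFamEdgeMomentsBeyondDiagonalTwoOrderAFESeries
import HarnessLib

/-!
# KMV 2000 (21)–(22) for TWO derivative orders: `Λ^{(i)}(f,½) Λ^{(j)}(f,½) = (1+(−1)^{i+j}) q̂ Σ_{n₁,n₂} λ_f(n₁)λ_f(n₂)(n₁n₂)^{−1/2} W_{ij}(q̂;n₁,n₂)`
# — a kernel theorem (helper for crux K_A `PrimeLevelFamEdge.MomentsBeyondDiagonal`, stmt-Parity-20007, line «petersson_layers» v4)

The deck `…PrimeLevelFamEdgeIdeaDeltasPeterssonLayersSplit` (§1, THE SEAM) builds every explicit piece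
(`spectralSum`, `diagPart`, `layer r`, …) on the TWO-ORDER exact approximate functional equation of the
products `Λ^{(i)}(f,½)Λ^{(j)}(f,½)` with the factor `1 + (−1)^{i+j}` and the weight `W_{ij} = KMV2000.afeW q̂ i j`;
the lead report g2 §3(b) records that this identity is «NOT KMV's printed (22) (one order k …) and is not a
typed fact at all», so that the ∀`Q` forms of `stub_first` / `stub_identP` / `stub_diag` had no input to rest
on. THIS FILE PROVES IT, for every level `N ≥ 1` and every Fricke eigen-cusp-form (`w_N f = εf`, `ε² = 1`), in
particular for newforms of prime level (Atkin–Lehner), by KMV's own real-variable route already used by the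
tree for `i = j` (`KMV2000.derivLambda_sq_eq_tsum_afeTerm_of_fricke`):
* `Λ^{(k)}(f,½) = 2π q̂^{1/2} A_k`, `A_k = ∫_0^∞ G_k`, `G_k(y) = f(iy)(log √N y)^k` (`derivLambda_eq_integral`);
* series side at two orders (step 1, `hasSum_logCutoffW_afe₂`): `Σ afeTerm i j = 4π² ∫ G_i · T_j`,
  `T_j(y) = ∫_{v>1/(Ny)} G_j`; and `afeTerm i j n₁ n₂ = afeTerm j i n₂ n₁` (symmetry of `W_{ij}`), so also
  `= 4π² ∫ G_j · T_i`;
* Fricke flip `T_k(y) = (−1)^k(−ε) H_k(y)`, `H_k(y) = ∫_0^y G_k` (`IsFrickeEigen.integral_imagAxis_Ioi_inv_mul_logPow`);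
* the two-function head integral `∫ (G_i H_j + G_j H_i) = A_i A_j` (FTC for `H_i H_j`, §1 below);
* the parity sign `(−1)^{k+1} ε A_k = A_k` (`sign_mul_integral_imagAxis_mul_logPow`).
Then `(1+(−1)^{i+j}) q̂ Σ afeTerm i j = 4π² q̂ (−1)^{j+1} ε (∫G_iH_j + ∫G_jH_i) = 4π² q̂ A_i A_j = Λ^{(i)}Λ^{(j)}`
— one algebraic identity, no parity case split (for `i + j` odd both sides vanish).
Proof only; no definition, no named fact; nothing about Landau–Siegel zeros; K_A is NOT proved here.
-/

noncomputable section

open scoped Real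
open Complex Set MeasureTheory Filter CongruenceSubgroup UpperHalfPlane
open _root_.Topology
open Literature.NumberTheory.EllipticCurves.ModularForms
open Literature.NumberTheory.LFunctions Literature.NumberTheory.LFunctions.KMV2000

namespace Summit.Parity.GeneralizedHardyLittlewood.Theorems.MomentsBeyondDiagonal.TwoOrderAFE

/-! ## §1. The two-function head integral (integration by parts for `H₁H₂`) -/

/-- **FTC for `H₁H₂`.** If `F₁, F₂ : ℝ → ℂ` are continuous and integrable on `(0, ∞)` and `H_m(y) = ∫_{0<u≤y} F_m`,
then `∫_{y>0} F₁H₂ + ∫_{y>0} F₂H₁ = (∫_{y>0} F₁)(∫_{y>0} F₂)` (the tree's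
`KMV2000.integral_Ioi_mul_integral_Ioc_eq_sq_div_two` is `F₁ = F₂`). [cite: KowalskiMichelVanderKam2000, §5 (21)–(22) p. 12] -/
theorem integral_Ioi_mul_integral_Ioc_add {F₁ F₂ : ℝ → ℂ}
    (h1i : IntegrableOn F₁ (Ioi 0)) (h1c : ContinuousOn F₁ (Ioi 0))
    (h2i : IntegrableOn F₂ (Ioi 0)) (h2c : ContinuousOn F₂ (Ioi 0)) :
    (∫ y in Ioi (0 : ℝ), F₁ y * ∫ u in Ioc (0 : ℝ) y, F₂ u) +
        ∫ y in Ioi (0 : ℝ), F₂ y * ∫ u in Ioc (0 : ℝ) y, F₁ u =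
      (∫ y in Ioi (0 : ℝ), F₁ y) * ∫ y in Ioi (0 : ℝ), F₂ y := by
  -- primitives, their derivatives, bounds, limits (as in the one-function lemma)
  have prim : ∀ {F : ℝ → ℂ}, IntegrableOn F (Ioi 0) → ContinuousOn F (Ioi 0) →
      (∀ y : ℝ, 0 < y → HasDerivAt (fun y ↦ ∫ u in Ioc (0 : ℝ) y, F u) (F y) y) ∧
      (∀ y : ℝ, ‖∫ u in Ioc (0 : ℝ) y, F u‖ ≤ ∫ u in Ioi (0 : ℝ), ‖F u‖) ∧
      ContinuousWithinAt (fun y ↦ ∫ u in Ioc (0 : ℝ) y, F u) (Ici 0) 0 ∧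
      Tendsto (fun y ↦ ∫ u in Ioc (0 : ℝ) y, F u) atTop (𝓝 (∫ y in Ioi (0 : ℝ), F y)) := by
    intro F hint hcont
    have hG_eq : ∀ y : ℝ, 0 ≤ y → (∫ u in Ioc (0 : ℝ) y, F u) = ∫ u in (0 : ℝ)..y, F u := fun y hy ↦ by
      rw [intervalIntegral.integral_of_le hy]
    refine ⟨fun y hy ↦ ?_, fun y ↦ ?_, ?_, ?_⟩
    · have hii : IntervalIntegrable F volume 0 y :=
        (intervalIntegrable_iff_integrableOn_Ioc_of_le hy.le).mpr (hint.mono_set Ioc_subset_Ioi_self)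
      have hmeas : StronglyMeasurableAtFilter F (𝓝 y) := hcont.stronglyMeasurableAtFilter isOpen_Ioi y hy
      have hcy : ContinuousAt F y := hcont.continuousAt (Ioi_mem_nhds hy)
      refine (intervalIntegral.integral_hasDerivAt_right hii hmeas hcy).congr_of_eventuallyEq ?_
      filter_upwards [Ioi_mem_nhds hy] with y' hy'
      exact hG_eq y' (le_of_lt hy')
    · calc ‖∫ u in Ioc (0 : ℝ) y, F u‖ ≤ ∫ u in Ioc (0 : ℝ) y, ‖F u‖ := norm_integral_le_integral_norm _
        _ ≤ ∫ u in Ioi (0 : ℝ), ‖F u‖ :=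
            setIntegral_mono_set hint.norm (Eventually.of_forall fun _ ↦ norm_nonneg _)
              Ioc_subset_Ioi_self.eventuallyLE
    · have hIcc : IntegrableOn F (Icc (0 : ℝ) 1) := by
        rw [integrableOn_Icc_iff_integrableOn_Ioc]
        exact hint.mono_set Ioc_subset_Ioi_self
      have h := intervalIntegral.continuousOn_primitive hIcc 0 (left_mem_Icc.mpr zero_le_one)
      exact h.mono_of_mem_nhdsWithin (Icc_mem_nhdsGE zero_lt_one)
    · have h := intervalIntegral_tendsto_integral_Ioi 0 hint tendsto_id
      refine h.congr' ?_
      filter_upwards [eventually_ge_atTop (0 : ℝ)] with y hy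
      exact (hG_eq y hy).symm
  obtain ⟨h1d, h1b, h1c0, h1lim⟩ := prim h1i h1c
  obtain ⟨h2d, h2b, h2c0, h2lim⟩ := prim h2i h2c
  set G₁ : ℝ → ℂ := fun y ↦ ∫ u in Ioc (0 : ℝ) y, F₁ u with hG₁
  set G₂ : ℝ → ℂ := fun y ↦ ∫ u in Ioc (0 : ℝ) y, F₂ u with hG₂
  set A₁ : ℂ := ∫ y in Ioi (0 : ℝ), F₁ y
  set A₂ : ℂ := ∫ y in Ioi (0 : ℝ), F₂ y
  have hG10 : G₁ 0 = 0 := by simp only [hG₁, Ioc_self, Measure.restrict_empty, integral_zero_measure]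
  have hG20 : G₂ 0 = 0 := by simp only [hG₂, Ioc_self, Measure.restrict_empty, integral_zero_measure]
  set Φ : ℝ → ℂ := fun y ↦ G₁ y * G₂ y with hΦ
  have hΦd : ∀ y ∈ Ioi (0 : ℝ), HasDerivAt Φ (F₁ y * G₂ y + F₂ y * G₁ y) y := by
    intro y hy
    refine ((h1d y hy).mul (h2d y hy)).congr_deriv ?_
    ring
  have hΦc0 : ContinuousWithinAt Φ (Ici 0) 0 := h1c0.mul h2c0
  have hΦlim : Tendsto Φ atTop (𝓝 (A₁ * A₂)) := h1lim.mul h2lim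
  have hG1m : AEStronglyMeasurable G₁ (volume.restrict (Ioi (0 : ℝ))) :=
    ContinuousOn.aestronglyMeasurable (fun y hy ↦ (h1d y hy).continuousAt.continuousWithinAt) measurableSet_Ioi
  have hG2m : AEStronglyMeasurable G₂ (volume.restrict (Ioi (0 : ℝ))) :=
    ContinuousOn.aestronglyMeasurable (fun y hy ↦ (h2d y hy).continuousAt.continuousWithinAt) measurableSet_Ioi
  have hF1G2 : IntegrableOn (fun y ↦ F₁ y * G₂ y) (Ioi (0 : ℝ)) :=
    Integrable.mul_bdd h1i hG2m (Eventually.of_forall h2b)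
  have hF2G1 : IntegrableOn (fun y ↦ F₂ y * G₁ y) (Ioi (0 : ℝ)) :=
    Integrable.mul_bdd h2i hG1m (Eventually.of_forall h1b)
  have hmain := integral_Ioi_of_hasDerivAt_of_tendsto hΦc0 hΦd (hF1G2.add hF2G1) hΦlim
  rw [integral_add hF1G2 hF2G1] at hmain
  rw [hmain]
  simp only [hΦ, hG10, hG20]
  ring

/-! ## §2. Symmetry of the two-order weight and summand -/

/-- `W_{ij}(q̂; n₁, n₂) = W_{ji}(q̂; n₂, n₁)` (the integrand is a product). [cite: KowalskiMichelVanderKam2000, (22) p. 12] -/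
theorem afeW_swap (qh : ℝ) (i j n₁ n₂ : ℕ) : afeW qh i j n₁ n₂ = afeW qh j i n₂ n₁ := by
  unfold afeW
  congr 1
  refine integral_congr_ae (Eventually.of_forall fun y ↦ ?_)
  ring

/-- `afeTerm N f i j n₁ n₂ = afeTerm N f j i n₂ n₁`. [cite: KowalskiMichelVanderKam2000, (22) p. 12] -/
theorem afeTerm_swap {N : ℕ} [NeZero N] (f : CuspForm (Gamma0 N) 2) (i j n₁ n₂ : ℕ) :
    afeTerm N f i j n₁ n₂ = afeTerm N f j i n₂ n₁ := by
  unfold afeTerm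
  rw [afeW_swap (qhat N) i j n₁ n₂]
  by_cases h : n₁ = 0 ∨ n₂ = 0
  · rw [if_pos h, if_pos (or_comm.mp h)]
  · rw [if_neg h, if_neg (fun h' ↦ h (or_comm.mp h')), mul_comm (n₂ : ℝ) (n₁ : ℝ)]
    ring

/-- The summand of the two-order series in closed real form off and on the axes:
`afeTerm N f i j n₁ n₂ = λ_f(n₁)λ_f(n₂)(n₁n₂)^{−1/2} W_{ij}(log q̂/n₁, log q̂/n₂; n₁n₂/q̂²)`.
[cite: KowalskiMichelVanderKam2000, (21)–(22) p. 12] -/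
theorem afeTerm_eq_logCutoffW₂ {N : ℕ} [NeZero N] (f : CuspForm (Gamma0 N) 2) (i j : ℕ) (n : ℕ × ℕ) :
    afeTerm N f i j n.1 n.2 =
      GL2Family.heckeLambda f n.1 * GL2Family.heckeLambda f n.2 *
          ((((n.1 : ℝ) * n.2) ^ (-(1 / 2 : ℝ)) : ℝ) : ℂ) *
          ((logCutoffW i j (Real.log (qhat N / n.1)) (Real.log (qhat N / n.2))
            ((n.1 : ℝ) * n.2 / qhat N ^ 2) : ℝ) : ℂ) := by
  obtain ⟨n₁, n₂⟩ := n
  by_cases h : n₁ = 0 ∨ n₂ = 0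
  · rw [afeTerm, if_pos h]
    rcases h with h | h
    · simp [h, heckeLambda_zero]
    · simp [h, heckeLambda_zero]
  · have h' := not_or.mp h
    rw [afeTerm, if_neg h, afeW_eq_logCutoffW (qhat_pos_of_neZero N) i j h'.1 h'.2]

/-! ## §3. The two-order exact AFE -/

variable {N : ℕ} [NeZero N]

/-- **KMV (21)–(22) at TWO orders `(i, j)` for every Fricke eigen-cusp-form, every level**: if
`f ∈ S₂(Γ₀(N))`, `w_N f = ε f`, `ε² = 1`, then the double series `Σ_{ℕ×ℕ} afeTerm N f i j` converges absolutely and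
`Λ^{(i)}(f,½) Λ^{(j)}(f,½) = (1 + (−1)^{i+j}) q̂ Σ'_{(n₁,n₂)} λ_f(n₁)λ_f(n₂)(n₁n₂)^{−1/2} W_{ij}(q̂;n₁,n₂)`.
[cite: KowalskiMichelVanderKam2000, (21)–(22) p. 12] -/
theorem derivLambda_mul_eq_tsum_afeTerm_of_fricke (f : CuspForm (Gamma0 N) 2) {ε : ℂ}
    (hfr : frickeInvolution N 2 f = ε • f) (hε : ε ^ 2 = 1) (i j : ℕ) :
    Summable (fun n : ℕ × ℕ ↦ ‖afeTerm N f i j n.1 n.2‖) ∧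
      derivLambda N i f * derivLambda N j f =
        (1 + (-1 : ℂ) ^ (i + j)) * (qhat N : ℂ) * ∑' n : ℕ × ℕ, afeTerm N f i j n.1 n.2 := by
  have hW : IsFrickeEigen N f ε := isFrickeEigen_of_frickeInvolution_eq_smul N hfr
  set G : ℕ → ℝ → ℂ := fun k y ↦ f (UpperHalfPlane.ofComplex (Complex.I * y)) *
    (((Real.log (Real.sqrt N * y)) ^ k : ℝ) : ℂ) with hG
  have hGi : IntegrableOn (G i) (Ioi 0) := integrableOn_imagAxis_mul_logPow f i
  have hGj : IntegrableOn (G j) (Ioi 0) := integrableOn_imagAxis_mul_logPow f j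
  have hΛi : derivLambda N i f = 2 * (π : ℂ) * ((qhat N : ℝ) : ℂ) ^ (1 / 2 : ℂ) * ∫ y in Ioi (0 : ℝ), G i y :=
    derivLambda_eq_integral f i
  have hΛj : derivLambda N j f = 2 * (π : ℂ) * ((qhat N : ℝ) : ℂ) ^ (1 / 2 : ℂ) * ∫ y in Ioi (0 : ℝ), G j y :=
    derivLambda_eq_integral f j
  -- the series at `(i, j)` and at `(j, i)`
  have hSij := hasSum_logCutoffW_afe₂ f i j
  have hSji := hasSum_logCutoffW_afe₂ f j i
  have hfun_ij : (fun n : ℕ × ℕ ↦ afeTerm N f i j n.1 n.2) =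
      fun n : ℕ × ℕ ↦ GL2Family.heckeLambda f n.1 * GL2Family.heckeLambda f n.2 *
          ((((n.1 : ℝ) * n.2) ^ (-(1 / 2 : ℝ)) : ℝ) : ℂ) *
          ((logCutoffW i j (Real.log (qhat N / n.1)) (Real.log (qhat N / n.2))
            ((n.1 : ℝ) * n.2 / qhat N ^ 2) : ℝ) : ℂ) := funext (afeTerm_eq_logCutoffW₂ f i j)
  have hfun_ji : (fun n : ℕ × ℕ ↦ afeTerm N f j i n.1 n.2) =
      fun n : ℕ × ℕ ↦ GL2Family.heckeLambda f n.1 * GL2Family.heckeLambda f n.2 *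
          ((((n.1 : ℝ) * n.2) ^ (-(1 / 2 : ℝ)) : ℝ) : ℂ) *
          ((logCutoffW j i (Real.log (qhat N / n.1)) (Real.log (qhat N / n.2))
            ((n.1 : ℝ) * n.2 / qhat N ^ 2) : ℝ) : ℂ) := funext (afeTerm_eq_logCutoffW₂ f j i)
  refine ⟨(summable_norm_iff.mpr hSij.summable).congr fun n ↦ by rw [afeTerm_eq_logCutoffW₂ f i j n], ?_⟩
  -- `X = Σ' afeTerm i j = Σ' afeTerm j i` (swap `(n₁,n₂) ↦ (n₂,n₁)`)
  set X : ℂ := ∑' n : ℕ × ℕ, afeTerm N f i j n.1 n.2 with hX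
  have hX1 : X = 4 * (π : ℂ) ^ 2 * ∫ y in Ioi (0 : ℝ), G i y * ∫ v in Ioi (((N : ℝ) * y)⁻¹), G j v := by
    rw [hX, hfun_ij, hSij.tsum_eq]
  have hX2 : X = 4 * (π : ℂ) ^ 2 * ∫ y in Ioi (0 : ℝ), G j y * ∫ v in Ioi (((N : ℝ) * y)⁻¹), G i v := by
    have hswap : X = ∑' n : ℕ × ℕ, afeTerm N f j i n.1 n.2 := by
      rw [hX, ← (Equiv.prodComm ℕ ℕ).tsum_eq (fun n : ℕ × ℕ ↦ afeTerm N f j i n.1 n.2)]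
      exact tsum_congr fun n ↦ by simp [Equiv.prodComm_apply, afeTerm_swap f i j]
    rw [hswap, hfun_ji, hSji.tsum_eq]
  -- Fricke flips of the inner tails
  have hT : ∀ (a b : ℕ), ∫ y in Ioi (0 : ℝ), G a y * ∫ v in Ioi (((N : ℝ) * y)⁻¹), G b v =
      (-1) ^ b * (-ε) * ∫ y in Ioi (0 : ℝ), G a y * ∫ u in Ioc (0 : ℝ) y, G b u := by
    intro a b
    rw [← integral_const_mul]
    refine setIntegral_congr_fun measurableSet_Ioi fun y hy ↦ ?_
    simp only [hG]
    rw [hW.integral_imagAxis_Ioi_inv_mul_logPow b hy]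
    ring
  -- head integrals and signs
  have hPQ := integral_Ioi_mul_integral_Ioc_add hGi (continuousOn_imagAxis_mul_logPow f i) hGj
    (continuousOn_imagAxis_mul_logPow f j)
  have hsj := sign_mul_integral_imagAxis_mul_logPow f j hW hε
  have hu : ((-1 : ℂ) ^ i) ^ 2 = 1 := by
    rw [← pow_mul, show i * 2 = 2 * i by ring, pow_mul]
    norm_num
  have hsq : (((qhat N : ℝ) : ℂ) ^ (1 / 2 : ℂ)) ^ 2 = (qhat N : ℂ) := by
    rw [← cpow_nat_mul]
    norm_num
  rw [hT i j] at hX1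
  rw [hT j i] at hX2
  simp only [hG] at hPQ hsj hX1 hX2
  rw [hΛi, hΛj]
  simp only [hG]
  set Ai : ℂ := ∫ y in Ioi (0 : ℝ), f (UpperHalfPlane.ofComplex (Complex.I * y)) *
    (((Real.log (Real.sqrt N * y)) ^ i : ℝ) : ℂ) with hAi
  set Aj : ℂ := ∫ y in Ioi (0 : ℝ), f (UpperHalfPlane.ofComplex (Complex.I * y)) *
    (((Real.log (Real.sqrt N * y)) ^ j : ℝ) : ℂ) with hAj
  set P : ℂ := ∫ y in Ioi (0 : ℝ), (f (UpperHalfPlane.ofComplex (Complex.I * y)) *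
      (((Real.log (Real.sqrt N * y)) ^ i : ℝ) : ℂ)) *
    ∫ u in Ioc (0 : ℝ) y, f (UpperHalfPlane.ofComplex (Complex.I * u)) *
      (((Real.log (Real.sqrt N * u)) ^ j : ℝ) : ℂ) with hP
  set Q : ℂ := ∫ y in Ioi (0 : ℝ), (f (UpperHalfPlane.ofComplex (Complex.I * y)) *
      (((Real.log (Real.sqrt N * y)) ^ j : ℝ) : ℂ)) *
    ∫ u in Ioc (0 : ℝ) y, f (UpperHalfPlane.ofComplex (Complex.I * u)) *
      (((Real.log (Real.sqrt N * u)) ^ i : ℝ) : ℂ) with hQ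
  set s : ℂ := ((qhat N : ℝ) : ℂ) ^ (1 / 2 : ℂ) with hs
  linear_combination (4 * (π : ℂ) ^ 2 * Ai * Aj) * hsq + (-(qhat N : ℂ)) * hX1 +
    (-((-1 : ℂ) ^ i * (-1 : ℂ) ^ j * (qhat N : ℂ))) * hX2 +
    (4 * (π : ℂ) ^ 2 * (-1 : ℂ) ^ j * (qhat N : ℂ) * ε * Q) * hu +
    (4 * (π : ℂ) ^ 2 * (qhat N : ℂ) * (-1 : ℂ) ^ j * ε) * hPQ + (-(4 * (π : ℂ) ^ 2 * (qhat N : ℂ) * Ai)) * hsj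

/-- **KMV (21)–(22) at two orders for newforms of any level** `N ≥ 1` (`w_N f = ε_f f`, `ε_f = ±1` by Atkin–Lehner:
`IsNewform0.frickeInvolution_eq_smul_holds`, `…frickeEigenvalue_eq_one_or_eq_neg_one_holds`); in particular for
`q` prime and `f ∈ S₂(q)^*` — the identity behind deck 21a's `spectralSum` (factor `1 + (−1)^{i+j}`, weight `W_{ij}`).
[cite: KowalskiMichelVanderKam2000, (21)–(22) p. 12] -/
theorem derivLambda_mul_eq_tsum_afeTerm_of_mem_newforms0 (f : CuspForm (Gamma0 N) 2)
    (hf : f ∈ newforms0 N 2) (i j : ℕ) :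
    Summable (fun n : ℕ × ℕ ↦ ‖afeTerm N f i j n.1 n.2‖) ∧
      derivLambda N i f * derivLambda N j f =
        (1 + (-1 : ℂ) ^ (i + j)) * (qhat N : ℂ) * ∑' n : ℕ × ℕ, afeTerm N f i j n.1 n.2 := by
  have hfr : frickeInvolution N 2 f = frickeEigenvalue f • f := IsNewform0.frickeInvolution_eq_smul_holds hf
  have hε : frickeEigenvalue f ^ 2 = 1 := by
    rcases IsNewform0.frickeEigenvalue_eq_one_or_eq_neg_one_holds (N := N) (k := (2 : ℤ)) hf with h | h <;>
      rw [h] <;> norm_num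
  exact derivLambda_mul_eq_tsum_afeTerm_of_fricke f hfr hε i j

end Summit.Parity.GeneralizedHardyLittlewood.Theorems.MomentsBeyondDiagonal.TwoOrderAFE

end
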